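import Mathlib
import HarnessLib
import Summits.RiemannHypothesis.RiemannHypothesis.Theorems.IntegerScrewDefs

/-!
# Route `IntegerScrew` — definitions: the CONTINUUM screw function `Ψ₀`, its Gram matrices and
# pivots, and the continuum deficit `c(M)` (A6-PIVOT theory, PIVOT-LAW §7.1)

Under RH Suzuki's screw function is a sum over the ordinates of `ζ`,
`Ψ(t) = ∑_{γ > 0} 2 (1 − cos γt) / γ²` ([cite: Suzuki2023, Thm 1.1(2), (1.9)]), so the screw Gram
matrices `S_M = screwMatrix (M − 1)` (`IntegerScrewDefs`) are sums of one rank-two atom per zero. The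
numerical programme on the nested pivots `d_M` (`screwPivot`) splits the measured pivot deficit
`G(M) = M·2Ψ(log(M/(M−1))) − M·d_M` into a CONTINUUM part — what remains when the zero-counting
measure is replaced by its smooth Riemann–von Mangoldt density `(1/2π) log(γ/2π) dγ` on `(2π, ∞)` — and
a GRAIN part carried by the fluctuations of the zeros about that density. This file only NAMES the
continuum objects so that statements about the split (e.g. «the grain part of the prime-octave means is
a pure power law», the cell's conjecture C-SOS-1′) can be typed against one definition of record:

* `continuumScrewDensity γ = log(γ/2π)/(2π)` — the smooth density of ordinates (no zeros enter);
* `continuumScrew t = Ψ₀(t) := ∫_{γ > 2π} 2(1 − cos(γt))/γ² · continuumScrewDensity γ dγ` — the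
  prime-free, pole-free screw function (by the explicit formula, `Ψ − Ψ₀` is the pole pair
  `8(cosh(t/2) − 1)` minus the prime sum `∑_{n ≤ e^t} Λ(n) n^{−1/2}(t − log n)`, up to the `O(T⁻²)` part of
  the density and the window `γ < 2π`); `Ψ₀(0) = 0`, `Ψ₀` is even, `Ψ₀(t) → 1/(2π²)`;
* `continuumScrewKernel t u = Ψ₀(t) + Ψ₀(u) − Ψ₀(t − u)` and `continuumScrewMatrix n`, the `n × n`
  matrix on the nodes `log 2, …, log(n+1)` (same indexing as `screwMatrix`: row `i ↔ m = i + 2`) — an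
  integral of positive-semidefinite rank-two atoms against a non-negative density, hence PSD on every node
  set with no hypothesis (not proved in this file);
* `continuumScrewDet n`, `continuumScrewPivot M = det K₀_M / det K₀_{M−1}` — the continuum LDLᵀ pivots
  `d⁰_M` (junk value for `M < 2` as for `screwPivot`);
* `continuumIncrementEnergy M = M · 2Ψ₀(log(M/(M−1)))` (`= log M − (log 2π + γ₀ − 1) + O(log M/M)`, the
  same leading terms as the true `L(M)`), and `continuumDeficit M = continuumIncrementEnergy M − M·d⁰_M`,
  the continuum deficit `c(M)` of PIVOT-LAW §7.1 (`c(M) = 0.701, 0.362, 0.169` at `M = 64, 512, 4096`;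
  about one fifth of the measured deficit at `M ≈ 2^12`).

Nothing here is progress on `ζ`: these are names of model quantities in which no zero of `ζ` and no
prime appears. Reference for `Ψ` and the kernel: M. Suzuki, J. Lond. Math. Soc. (2) 108 (2023)
1448–1487 = arXiv:2206.03682, (1.1), (1.4), (1.9) [Suzuki2023]; the continuum split is the cell's
(rh-explicit, A6-PIVOT / SOS tracks), not Suzuki's.
-/

noncomputable section

-- D-0017: `Summit.<S>.<S>.…` is the designed namespace of a single-problem summit.
set_option linter.dupNamespace false

namespace Summit.RiemannHypothesis.RiemannHypothesis.Theorems.IntegerScrew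

open Real MeasureTheory

/-- The smooth (Riemann–von Mangoldt) density of ordinates, `ρ(γ) = log(γ/2π)/(2π)`
(non-negative exactly for `γ ≥ 2π`). [folklore] -/
def continuumScrewDensity (γ : ℝ) : ℝ :=
  Real.log (γ / (2 * π)) / (2 * π)

/-- The CONTINUUM SCREW FUNCTION
`Ψ₀(t) = ∫_{γ > 2π} 2 (1 − cos(γ t)) / γ² · ρ(γ) dγ`, `ρ = continuumScrewDensity`: Suzuki's
`Ψ(t) = ∑_{γ>0} 2(1 − cos γt)/γ²` (under RH, [cite: Suzuki2023, (1.9)]) with the zero-counting measure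
replaced by its smooth density on `(2π, ∞)`. The integrand is `O(log γ / γ²)`, so the integral converges
absolutely for every real `t`. [folklore] -/
def continuumScrew (t : ℝ) : ℝ :=
  ∫ γ in Set.Ioi (2 * π), 2 * (1 - Real.cos (γ * t)) / γ ^ 2 * continuumScrewDensity γ

/-- The continuum kernel `K₀(t,u) = Ψ₀(t) + Ψ₀(u) − Ψ₀(t − u)` (the analogue of
`Literature.NumberTheory.LFunctions.zetaScrewKernel` for `Ψ₀`). [folklore] -/
def continuumScrewKernel (t u : ℝ) : ℝ :=
  continuumScrew t + continuumScrew u - continuumScrew (t - u)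

/-- The `n × n` CONTINUUM GRAM MATRIX on the nodes `log 2, …, log(n+1)`:
`continuumScrewMatrix n i j = K₀(log(i+2), log(j+2))` (row `i ↔ m = i + 2`, as for `screwMatrix`).
[folklore] -/
def continuumScrewMatrix (n : ℕ) : Matrix (Fin n) (Fin n) ℝ :=
  Matrix.of fun i j =>
    continuumScrewKernel (Real.log (((i : ℕ) + 2 : ℕ) : ℝ)) (Real.log (((j : ℕ) + 2 : ℕ) : ℝ))

/-- `continuumScrewDet n = det (continuumScrewMatrix n)` (`continuumScrewDet 0 = 1`). [folklore] -/
def continuumScrewDet (n : ℕ) : ℝ :=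
  (continuumScrewMatrix n).det

/-- The `M`-th continuum LDLᵀ pivot `d⁰_M = det K₀_M / det K₀_{M−1} =
continuumScrewDet (M − 1) / continuumScrewDet (M − 2)` (junk value for `M < 2`, as for `screwPivot`).
[folklore] -/
def continuumScrewPivot (M : ℕ) : ℝ :=
  continuumScrewDet (M - 1) / continuumScrewDet (M - 2)

/-- The continuum one-step increment energy `L₀(M) = M · 2Ψ₀(log(M/(M−1)))` — the squared length of
the increment of the continuum screw line between the nodes `log(M−1)` and `log M`, scaled by `M`
(meaningful for `M ≥ 3`; at `M = 2` the argument is `log 2`). [folklore] -/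
def continuumIncrementEnergy (M : ℕ) : ℝ :=
  (M : ℝ) * (2 * continuumScrew (Real.log ((M : ℝ) / ((M : ℝ) - 1))))

/-- The CONTINUUM DEFICIT `c(M) = L₀(M) − M · d⁰_M`: the part of the one-step increment energy that a
linear predictor from the nodes `log 2, …, log(M−1)` removes when the spectral measure of the screw
line is the smooth density alone (PIVOT-LAW §7.1; numerically `c(64) = 0.701`, `c(512) = 0.362`,
`c(4096) = 0.169`). [folklore] -/
def continuumDeficit (M : ℕ) : ℝ :=
  continuumIncrementEnergy M - (M : ℝ) * continuumScrewPivot M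

/-- `Ψ₀(0) = 0`: the integrand vanishes identically at `t = 0`. -/
theorem continuumScrew_zero : continuumScrew 0 = 0 := by
  simp [continuumScrew]

/-- `Ψ₀` is even, because the integrand depends on `t` only through `cos(γ t)`. -/
theorem continuumScrew_neg (t : ℝ) : continuumScrew (-t) = continuumScrew t := by
  simp [continuumScrew, mul_neg, Real.cos_neg]

/-- The continuum kernel vanishes on the axis `t = 0` (the node `log 1 = 0` carries nothing), as for the
true kernel (`zetaScrewKernel_zero_left`). -/
theorem continuumScrewKernel_zero_left (u : ℝ) : continuumScrewKernel 0 u = 0 := by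
  simp [continuumScrewKernel, continuumScrew_zero, continuumScrew_neg]

/-- The continuum kernel is symmetric. -/
theorem continuumScrewKernel_comm (t u : ℝ) :
    continuumScrewKernel t u = continuumScrewKernel u t := by
  have h : continuumScrew (t - u) = continuumScrew (u - t) := by
    rw [← continuumScrew_neg (t - u), neg_sub]
  simp only [continuumScrewKernel, h]
  ring

/-- On the diagonal the continuum kernel is `2Ψ₀(t)`. -/
theorem continuumScrewKernel_self (t : ℝ) : continuumScrewKernel t t = 2 * continuumScrew t := by
  simp [continuumScrewKernel, continuumScrew_zero]
  ring

/-- The continuum Gram matrix is symmetric. -/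
theorem continuumScrewMatrix_isSymm (n : ℕ) : (continuumScrewMatrix n).IsSymm := by
  ext i j
  simp [continuumScrewMatrix, continuumScrewKernel_comm]

end Summit.RiemannHypothesis.RiemannHypothesis.Theorems.IntegerScrew
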